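import Summits.SmoothPoincare4.SmoothPoincare4.Theses.CongruenceShadows
import Literature.Topology.FourManifolds.SPC4HandlesTwoHandlebodyGenusCount

/-!
# Stub `stub_fillingUniqueness` of line `lp-by-sphere-system-surgery` for crux `AgkCor6Sufficiency`
(item stmt-SmoothPoincare4-10894, routes CongruenceShadows / GroupTrisection; lead reshape r1)

"Filling uniqueness" — every diffeomorphism between the boundaries of two compact connected
orientable smooth `4`-dimensional `1`-handlebodies extends to a diffeomorphism of the
handlebodies (Meier–Scott 2025, Thm. 4.1(2) with `G = 1`, Prop. 4.8 form (2)) — FROM the tree's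
Laudenbach–Poénaru fact `Literature.Topology.FourManifolds.exists_diffeomorph_comp_incl_eq.{0}`
(taken as hypothesis: it is the registered delegated fact `stub_laudenbachPoenaru` of the line).
The proof is (verbatim) the drefuter's kernel-checked
`Summit.SmoothPoincare4.SmoothPoincare4.Theorems.AgkCor6Sufficiency.Negative.fillingUniqueness_of_laudenbachPoenaru`
(`Negative/FillingUniquenessIffLP.lean`, inlined here: pick `Ψ₀ : V ≅ V'` by the tree's PROVED classification of
compact connected orientable `1`-handlebodies by their boundary — NORM, genus count, UNIQ₄ —,
extend `ψ ≫ (∂Ψ₀)⁻¹` over `V` by LP, compose; Matsumoto 2001, proof of Lemma 5.20).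

This file declares the line's statement `FillingUniqueness` (verbatim from the checked skeleton
`Cruxes/AgkCor6Sufficiency/Lines/lp-by-sphere-system-surgery.lean`; the gate matches registered
stubs by name and signature) and proves the registered stub
`stub_fillingUniqueness : exists_diffeomorph_comp_incl_eq.{0} → FillingUniqueness`.
-/

noncomputable section

-- the prescribed namespace `Summit.<P>.<Sub>.…` duplicates `SmoothPoincare4` (P = Sub)
set_option linter.dupNamespace false

open Set Function
open scoped Manifold ContDiff Topology

namespace Summit.SmoothPoincare4.SmoothPoincare4.Cruxes.AgkCor6Sufficiency.LpBySphereSystemSurgery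

open Literature.Topology.FourManifolds

/-- **Filling uniqueness** (Meier–Scott 2025, Thm 4.1(2) with `G = 1`, in the form Prop 4.8(2)):
for compact connected orientable smooth `4`-dimensional `1`-handlebodies `V, V'` (handles of index
`≤ 1`), every diffeomorphism `ψ : ∂V ≅ ∂V'` of the boundary `3`-manifolds extends to a
diffeomorphism `Ψ : V ≅ V'` (`Ψ ∘ incl = incl' ∘ ψ`).  (`∂V ≅ ∂V'` forces equal numbers of
`1`-handles by `π₁`; `V ≅ V'` is the tree's proved UNIQ₄; the content is the rel-boundary
uniqueness of `1`-handlebody fillings.)  Statement of the line's skeleton, verbatim. -/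
def FillingUniqueness : Prop :=
  ∀ (V V' : Type) [TopologicalSpace V] [T2Space V] [SecondCountableTopology V] [CompactSpace V]
    [ConnectedSpace V] [ChartedSpace (EuclideanHalfSpace 4) V] [IsManifold (𝓡∂ 4) ∞ V]
    [TopologicalSpace V'] [T2Space V'] [SecondCountableTopology V'] [CompactSpace V']
    [ConnectedSpace V'] [ChartedSpace (EuclideanHalfSpace 4) V'] [IsManifold (𝓡∂ 4) ∞ V']
    (_ : IsHandlebodyOfIndexLE 3 1 V) (_ : IsHandlebodyOfIndexLE 3 1 V')
    (_ : IsOrientable (𝓡∂ 4) V) (_ : IsOrientable (𝓡∂ 4) V')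
    (b : BoundaryData (𝓡∂ 4) V (𝓡 3)) (b' : BoundaryData (𝓡∂ 4) V' (𝓡 3))
    (ψ : b.carrier ≃ₘ⟮𝓡 3, 𝓡 3⟯ b'.carrier),
    ∃ Ψ : V ≃ₘ⟮𝓡∂ 4, 𝓡∂ 4⟯ V', ⇑Ψ ∘ b.incl = b'.incl ∘ ⇑ψ

/-- **Stub `stub_fillingUniqueness`**: Laudenbach–Poénaru's extension theorem gives filling
uniqueness (Matsumoto 2001, proof of Lemma 5.20: boundary classification of compact connected
orientable `1`-handlebodies + LP + composition; the drefuter's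
`Negative.fillingUniqueness_of_laudenbachPoenaru`). [cite: Matsumoto2001, §5.3, proof of Lemma 5.20] -/
theorem stub_fillingUniqueness :
    exists_diffeomorph_comp_incl_eq.{0} → FillingUniqueness := by
  intro hLP V V' _ _ _ _ _ _ _ _ _ _ _ _ _ _ hV hV' ho ho' b b' ψ
  -- same proof as `Negative.fillingUniqueness_of_laudenbachPoenaru` (inlined: that module is
  -- not yet built on the farm at the time of writing)
  obtain ⟨Ψ₀⟩ := nonempty_diffeomorph_of_isHandlebodyOfIndexLE_one_of_boundary_homeomorph V V'
    hV hV' ho ho' b b' ψ.toHomeomorph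
  obtain ⟨Φ, hΦ⟩ := hLP V hV ho b (ψ.trans (b.restrictDiffeomorph b' Ψ₀).symm)
  refine ⟨Φ.trans Ψ₀, funext fun z => ?_⟩
  have h1 : Φ (b.incl z) = b.incl ((ψ.trans (b.restrictDiffeomorph b' Ψ₀).symm) z) :=
    congrFun hΦ z
  rw [Diffeomorph.coe_trans, comp_apply, comp_apply, h1,
    ← BoundaryData.incl_restrictDiffeomorph (b₂ := b') Ψ₀]
  simp only [Diffeomorph.coe_trans, comp_apply, Diffeomorph.apply_symm_apply]

end Summit.SmoothPoincare4.SmoothPoincare4.Cruxes.AgkCor6Sufficiency.LpBySphereSystemSurgery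

end
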